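import Literature.MathematicalPhysics.QuantumFieldTheory.Balaban1983to89.T4RelativeCombGradient
import Literature.MathematicalPhysics.QuantumFieldTheory.Balaban1983to89.T4BlockTransport

/-!
# `Balaban1983to89.T4CombHolderWindow` — the LATTICE (sup, ∇, Hölder) WINDOW NORM of a bond field on one block,
# the birth slice's abstract window-norm slot `N` READ AS IT, the window transport theorem, and its feeding from
# the relative comb gauge lineage (cell row T4-O3.E-NE1′-OG1′-RESID-R3*, node O3, estimate NE1′, located
# obligation O-G1′; residual (R3) of GAPS G-pv24g10-1)

PRINTED (read from the page renders by this seat unless marked COPY; B8 = [Balaban1985RegularSpaces], B9 =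
[Balaban1985BackgroundPropagators], B12 = [Balaban1987RG1]):
* B8 p. 82 (render `…regular-spaces-gauge-fixing-p008`): "Σ_k ⊂ {a set of configurations U = U₁U₀,
  U ∈ 𝔘_k({Ω_j}, α₀), U₁ = e^{iηA}, |A| < O(α₀(L^jη)^{−1}), |∇^η_{U₀}A| < O(α₀(L^jη)^{−2}) on Ω_j, Q(U₀, ηA) = B,
  R(U₀)D^{η*}_{U₀}A = 0}. (1.32)"; "Now our problem is to construct a gauge transformation u satisfying the
  equalities (1.29) and such that U₁ = U′u^{−1} satisfies the conditions U₁ = e^{iηA}, |A| < B₁(α₀ + α₁)(L^jη)^{−1},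
  |∇^η_{U₀}A| < B₁(α₀ + α₁)(L^jη)^{−2}, ‖A‖_{1,β} < B₂(β₀)(α₀ + α₁)(L^jη)^{−2−β}, β ≦ β₀ < 1, on Ω_j,
  j = 0, 1, …, k, (1.36) Q_j(U₀, ηA) = B on Λ_j, j = 0, 1, …, k, B is given by formula (1.31) with V′ = Ū′^j,
  |B| < 2dLα₁ by the assumption (1.35), (1.37) R(U₀)D^{η*}_{U₀}A = 0. (1.38)"
  [cite: Balaban1985RegularSpaces, (1.32)–(1.38) p. 82]
* B9 p. 396 (render `…background-propagators-p008`): "|A| < O(1)Mα₀(L^jη)^{−1}, |∇^ηA| < O(1)Mα₀(L^jη)^{−2} on □,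
  where O(1)M is a size of □ in T_{L−j}; (3.35) |∂^{η*}∂^ηA| < O(1)Mα₀(L^jη)^{−3} on □. (3.36)"; "U satisfies the
  condition (3.35), and |A′| < α₁(L^jη)^{−1}, |∇^η_UA′| < α₁(L^jη)^{−2} on Ω_j, j = 0, …, k; (3.37) U satisfies (3.35),
  (3.36), A′ satisfies (3.37) and |D^{η*}_UD^η_UA′| < α₁(L^jη)^{−3} on Ω_j, j = 0, …, k. (3.38)"
  [cite: Balaban1985BackgroundPropagators, (3.35)–(3.38) p. 396]
* B9 p. 397 (render `…background-propagators-p009`): "To formulate the regularity and decay properties we have to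
  introduce several norms. They are identical to the norms used in [3, 4], e.g., given by (1.108), (1.109), but the
  derivatives there have to be replaced by the corresponding covariant derivatives determined by a configuration U.
  Thus we have the supremum norms |A| = max_μ sup_x |A_μ(x)|, |∇A| = max_{μ,ν} sup_x |(D_μA_ν)(x)|, (3.39) and the
  Hölder norms ‖A‖_α = max_μ sup_{x,x′:|x−x′|≤1} (1/|x′ − x|^α)|R(U(Γ_{x,x′}))A_μ(x′) − A_μ(x)|, (3.40) ‖A‖_{1,α} =
  ‖∇A‖_α = max_{μ,ν} sup_{x,x′:|x−x′|≤1} (1/|x′ − x|^α)|R(U(Γ_{x,x′}))(D_μA_ν)(x′) − (D_μA_ν)(x)|, where Γ_{x,x′} is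
  a shortest contour connecting points x and x′. It is understood that the η-scale is used in the above
  definitions. If we use another scale, then it is indicated explicitly by a superscript"; "We define for an
  arbitrary real number α |A|_{(α)} = sup_{0≤j≤k} sup_{b∈Ω_j∖Ω_{j+1}} (L^jη)^{−α}|A(b)|. (3.41)"
  [cite: Balaban1985BackgroundPropagators, (3.39)–(3.41) p. 397]
* COPY (quotations certified in the header of `T4BirthChartTransport`, XREAD C-pv20-33; NOT re-read by this seat):
  B12 p. 272 "the function (3.13) is analytic in 𝐀, for 𝐀 satisfying the conditions |𝐀|, |P₁𝐀|, |∇^ξ_U𝐀|,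
  |Δ^ξ_U𝐀| < α₂ on X. (3.14)"; p. 276 "(3.31) |𝐀|, |∇^η𝐀|, ‖𝐀‖_{1,β} < α₂ on □₀"; p. 277 "(3.32) |A|, |∇^ηA|,
  ‖A‖_{1,β} < 2(α₂ + B₃O(1)Mα₀)".
  [cite: Balaban1987RG1, (3.14) p. 272, (3.31)–(3.32) pp. 276–277]

HONEST FRAMING (cell `pub-balaban`, T4-DAG PAGE 1).  The cell's T4 target is the existence AND uniqueness of the
continuum limit of Bałaban's unit-scale averaged loop expectations on a FINITE four-torus, at rung (B)+1 of the cell's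
ladder — CONDITIONAL on the perturbative β-function hypothesis BetaPertH and on the running-coupling hypotheses
(B)/(B^μ) wherever a consumer uses them (none is used IN this file); it is NOT an infinite-volume statement, NOT the
Yang–Mills mass gap and NOT the Clay problem.  NO statement about Bałaban's renormalization-group objects is asserted:
birth slice, gauge invariance, curvature / gradient / second-difference bounds are HYPOTHESIS SHAPES / binders.

THE QUESTION LEFT (GAPS G-pv24g10-1, residual (R3), verbatim): "the Hölder WINDOW NORM itself: a DEFINITION of a
lattice ‖·‖_{1,β}-type norm of a bond field on a block (sup + sup of first η-quotients + β-quotient of first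
η-quotients, with the powers of L^jη of (1.36)/(3.31)) and the instantiation of `T4BirthChartTransport.BirthSlice`'s
abstract `N` by it, so that a first-difference window is CONSUMED by the T4 chain (today `T4BlockTransport.latN`
consumes SUP only)."  Upstream state: `T4BirthChartTransport.BirthSlice Fn move N 𝒦 w r A` keeps the window norm
`N : Dir → ℝ` ABSTRACT (its docstring: "`N d` = the `j`-window norm `max(|𝐀|, |∇𝐀|, ‖𝐀‖_{1,β})` of [Balaban1987RG1]
(3.31)"); the only lattice consumer, `T4BlockTransport.block_transport`, instantiates `Dir := NDir` = (bond field,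
declared SUP bound) and `N := latN` = that sup; the pv24 lineage (`T4RelativeCombGradient`) bounds the FIRST LATTICE
DIFFERENCES of the comb defect (`norm_gradient_le`, `norm_gradient_le_raw`) and records the Hölder interpolation
`norm_sub_le_holder` — with no consumer so far.

WHAT THIS FILE DOES (bookkeeping on the existing seam; every analytic input stays a hypothesis).
§1 lattice helpers (coordinates of `x + e_ν`, `x + m·e_ρ`; convexity of the corner block along an axis).
§2 `fdiff` (the PLAIN forward lattice difference), the window triple `Win = (b₀, b₁, b₂)`, the weighted window norm
   `winN κ b = max(b₀/κ₀, b₁/κ₁, b₂/κ₂)` (`winN_le_iff`: `≤ w` iff each slot `≤ w·κ_i`), and `WindowData L z β D b` :=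
   nonnegative entries ∧ global sup `≤ b₀` ∧ first differences `≤ b₁` on interior bond pairs of `B(z)` ∧
   axis-parallel `β`-Hölder quotients of first differences `≤ b₂·m^β`; constructors `WindowData.of_grad` (CRUDE
   Hölder entry `2b₁`) and `WindowData.of_secondDiff` (INTERPOLATED entry `(2b₁)^{1−β}σ^β` from a second-difference
   bound `σ`, via `norm_sub_le_holder_fin`, a finite-path form of `T4RelativeCombGradient.norm_sub_le_holder`).
§3 window directions `WDir` (bond field + certified window data), the window chart `wMove` (= the affine lattice
   chart of `T4BlockTransport.latMove`) and `wN κ` (= `winN κ` of the declared triple); the NAMED zero-extended block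
   deviation `blockDev L z g U₀ U₁` (the direction `block_transport` builds in a local `let`); THE WINDOW TRANSPORT
   THEOREM `block_transport_window`: `GaugeInvariant (BlockRel L z) Fn`, `BirthSlice Fn (wMove L z β) (wN L z β κ) 𝒦
   w r A`, `κ > 0`, `0 < r`, `0 ≤ A`, `val U₀ ∈ 𝒦`, unitary-like `g`, `WindowData L z β (blockDev L z g U₀ U₁) b`,
   `winN κ b ≤ w` ⟹ `‖Fn (val U₁) − Fn (val U₀)‖ ≤ (4A/r)·winN κ b` (same mechanism as `block_transport`:
   `transport_of_birthChart` with the window direction as the relative-gauge witness; `winN κ b = 0` forces `b₀ = 0`,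
   a block-gauge related pair, difference `0`).
§4 the SEAM COMPARISON `birthSlice_window_of_sup`: for `κ₀ ≤ 1` today's sup slice (`BirthSlice Fn latMove latN`)
   IMPLIES the window slice — the window slice is the WEAKER hypothesis on `Fn` (analyticity asked only along
   directions small in all three slots, the printed format (3.14)/(3.31)); the converse is not claimed.
§5 feeding from the comb lineage with `g :=` the relative comb gauge (BY NAME): sup entry `C·s` (`norm_dev_le`;
   `C = (d−1)(L−1)`, `s` = block sup of the GAUGE-FIXED relative plaquette deviation;
   `T4RelativeComb.norm_defect_sub_one_le_ladderLen` + `ladderLen_le` + `‖U₀‖ ≤ 1`), gradient entry `G + C·s·γU` from a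
   defect-gradient datum `G` and the base bond gradient `γU` (`norm_fdiff_dev_le`: `(W′−1)U₀′ − (W−1)U₀ = (W′−W)U₀′ +
   (W−1)(U₀′−U₀)`), `windowData_comb` (crude Hölder entry), `windowData_comb_raw` (`G := gradRaw …` DISCHARGED by
   `T4RelativeCombGradient.norm_gradient_le_raw` from the block sup data `s, q₀, q₁, τ₀, τ₁, γU, γ₀, γ₁`),
   `windowData_comb_secondDiff` (declared `σ`), and the end-to-end corollaries `block_transport_comb_window`,
   `block_transport_comb_window_raw`: from block sup data of a unitary-like pair to `‖Fn U₁ − Fn U₀‖ ≤ (4A/r)·N_κ(b)`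
   with a FIRST-DIFFERENCE window consumed.
§6 [arith] the printed-format weights `printWin θ β = (θ, θ², θ^{2+β})`, `θ = L^{−j}` [CELL READING of (1.36) in
   bond-variable units, derivation in the docstring], `crude_needs` (the crude Hölder entry forces `b₁ ≤
   (a/2)·θ^{2+β}`, a LOSS of `θ^β` against the gradient slot — it does not close the printed window uniformly in
   `j`), `interp_exponent` (`(θ²)^{1−β}(θ³)^β = θ^{2+β}`: second differences at the (3.36)/(3.38) rate feed the Hölder
   slot EXACTLY at the printed rate), `interp_hol_entry`.
§7 non-vacuity (zero field / trivial pair have window data `(0,0,0)`; constant functionals inhabit the window slice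
   and the invariance; the non-trivial toys of the transport mechanism are upstream).

HONEST SCOPE / NOT CLAIMED.  (a) PLAIN lattice differences of `R`-valued bond variables: NO covariant derivative
`∇_U`, NO parallel transport `R(U(Γ_{x,x′}))` in the Hölder quotient (print (3.39)/(3.40) has both) — for unitary-like
`U₀` near `1` the two formats differ by cross terms, NOT estimated here; (b) Hölder pairs are AXIS-PARALLEL
(`x′ = x + m·e_ρ`) inside one block, distances counted in lattice STEPS `m` (print: all pairs `|x − x′| ≤ 1` in the
η-scale, shortest contours); (c) bond-variable units (`U − 1`-type quantities); the identification `θ = L^{−j}` and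
the powers of `η` are a CELL READING (§6), not print; (d) ONE block `B(z)`, unitary-like pairs only — no patching
across blocks, no window `K` of `T4RelativeCombWindow`, no complex (Gᶜ-valued) gauge; (e) the second-difference
datum `σ` (residual (R2) of GAPS G-pv24g10-1) is a HYPOTHESIS — the comb lineage supplies sup and first differences
only, so the DISCHARGED window (`windowData_comb_raw`) carries the CRUDE Hölder entry, with the loss recorded in §6;
(f) nothing about Bałaban's renormalization transformations, effective densities, or the validity of the birth
slice for them is asserted — `BirthSlice` stays a hypothesis SHAPE, now over window directions; (g) NOT summit
progress: rung (B)+1 bookkeeping on a FINITE torus ≠ infinite volume / mass gap / Clay.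

NOVELTY / NEAREST PRINT (records, NOT sources).  Inside the series the window format is (1.36)/(3.31)/(3.39)–(3.40)
above; the lattice instantiation for the relative comb defect of TWO configurations is cell-side (GAPS C-pv04g14-2,
A-t4lit1-3a, A-t4lit16-1: no printed counterpart located).  Outside the series the nearest printed Hölder-window
statement for a gauge-fixed lattice field obtained from curvature data is, per the cell's literature lineage
(`t4/T4-LITERATURE.md` v18 §1.36), Chevyrev, CMP 372 (2019) §4 Thm 4.12 (ONE configuration, d = 2, Landau-type gauge;
axial gauge: sup only, Prop. 4.15) [bib `Chevyrev2019YMMeasure`] — NAMED as precedent; nothing of it is used.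

LABELS.  [printed] = quoted above; [folklore] = elementary normed-ring algebra / lattice bookkeeping on abstract
data; [cell reading] = the unit/scale dictionary of §6; (arith) = real arithmetic.  IMPORTS BY NAME ONLY (one-writer
files of other lineages are never edited): `T4BlockTransport` (t4-ne1p-p1: `Fld`, `val`, `NDir`, `latN`, `latMove`,
`BlockRel`), `T4BirthChartTransport` (pv20: `GaugeInvariant`, `BirthSlice`, `RelGauge`, `transport_of_birthChart`,
`sub_eq_zero_of_rel`), `T4RelativeComb` (pv04: `Cfg`, `gaugeAct`, `plaq`, `PlaqSup`, `combGauge`, `defect`,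
`ladderLen_le`, `norm_defect_sub_one_le_ladderLen`), `T4RelativeCombGradient` (pv24, this lineage:
`norm_gradient_le_raw`, `norm_sub_le_holder`), `B8Lemma1Lattice` (`e`, `site`, `InBlock`).
-/

namespace Literature.MathematicalPhysics.QuantumFieldTheory.Balaban1983to89.T4CombHolderWindow

open Set
open B8Lemma1Lattice (e site site_add_single InBlock inBlock_site_iff exists_offset_of_inBlock)
open T4RelativeLadder (UnitaryLike)
open T4RelativeComb (Cfg gaugeAct plaq PlaqSup combGauge unitaryLike_combGauge defect ladderLen ladderLen_le
  norm_defect_sub_one_le_ladderLen)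
open T4RelativeCombGradient (norm_gradient_le norm_gradient_le_raw norm_sub_le_holder)
open T4BirthChartTransport (GaugeInvariant BirthSlice RelGauge transport_of_birthChart sub_eq_zero_of_rel)
open T4BlockTransport (Fld val val_apply NDir latN latMove latMove_zero BlockRel blockRel_refl block_transport)

variable {R : Type*} [NormedRing R] {d : ℕ}

/-- [folklore] Sites of `ℤ^d` — the SAME carrier as `B8Lemma1Lattice.Site d` / `T4BlockTransport.Site d`
(definitionally; re-declared here only so that the bare name is not captured by an ancestor namespace). -/
abbrev Site (d : ℕ) : Type := Fin d → ℤ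

example (d : ℕ) : Site d = T4BlockTransport.Site d := rfl

/-! ## §1  Lattice geometry helpers: coordinates of shifted sites, convexity of the block -/

/-- [folklore] Coordinates of `x + e_ν`. -/
theorem add_e_apply (x : Site d) (ν κ : Fin d) : (x + e ν) κ = x κ + if κ = ν then 1 else 0 := by
  simp [e, Pi.single_apply]

/-- [folklore] Coordinates of `x + m·e_ρ`. -/
theorem add_nsmul_e_apply (x : Site d) (ρ : Fin d) (m : ℕ) (κ : Fin d) :
    (x + m • e ρ) κ = x κ + if κ = ρ then (m : ℤ) else 0 := by
  by_cases h : κ = ρ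
  · subst h; simp [e]
  · simp [e, h]

/-- [folklore] CONVEXITY of the corner-anchored block in one coordinate direction: if `x` and `x + e_μ + e_ν` lie
in `B(z)` then so does `x + e_ν`. -/
theorem inBlock_add_of_add_add {L : ℕ} {z x : Site d} {μ ν : Fin d} (hx : InBlock L z x)
    (hxμν : InBlock L z (x + e μ + e ν)) : InBlock L z (x + e ν) := by
  intro κ
  have h1 := hx κ
  have h2 := hxμν κ
  rw [add_e_apply, add_e_apply] at h2
  rw [add_e_apply]
  split_ifs at h2 ⊢ <;> omega

/-- [folklore] CONVEXITY along a lattice axis: if `x` and `x + m·e_ρ` lie in `B(z)` then so does `x + i·e_ρ` for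
every `i ≤ m`. -/
theorem inBlock_add_nsmul_of_le {L : ℕ} {z x : Site d} {ρ : Fin d} {m i : ℕ} (hx : InBlock L z x)
    (hxm : InBlock L z (x + m • e ρ)) (hi : i ≤ m) : InBlock L z (x + i • e ρ) := by
  intro κ
  have h1 := hx κ
  have h2 := hxm κ
  rw [add_nsmul_e_apply] at h2 ⊢
  split_ifs at h2 ⊢ <;> omega

/-- [folklore] `x + i·e_ρ + y = (x + y) + i·e_ρ` — commuting a translate past the axis shift. -/
theorem add_nsmul_add_comm (x y : Site d) (ρ : Fin d) (i : ℕ) : x + i • e ρ + y = x + y + i • e ρ :=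
  add_right_comm _ _ _

/-- [folklore] One more step along the axis: `x + (i+1)·e_ρ = (x + i·e_ρ) + e_ρ`. -/
theorem add_succ_nsmul (x : Site d) (ρ : Fin d) (i : ℕ) : x + (i + 1) • e ρ = x + i • e ρ + e ρ := by
  rw [succ_nsmul, add_assoc]

/-! ## §2  Lattice window data of a bond field on one block; the weighted window norm -/

/-- [folklore] The PLAIN forward lattice difference in direction `μ` of an `R`-valued bond field:
`(∂_μ D)⟨x, x+e_ν⟩ := D⟨x+e_μ, x+e_μ+e_ν⟩ − D⟨x, x+e_ν⟩` (NO parallel transport, NO covariant derivative — see the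
HONEST SCOPE of the header). -/
def fdiff (D : Fld d R) (μ : Fin d) (x : Site d) (ν : Fin d) : R := D (x + e μ) ν - D x ν

/-- [folklore] `fdiff` evaluates by its defining formula. -/
@[simp] theorem fdiff_apply (D : Fld d R) (μ : Fin d) (x : Site d) (ν : Fin d) :
    fdiff D μ x ν = D (x + e μ) ν - D x ν := rfl

/-- [folklore] A WINDOW TRIPLE `(b₀, b₁, b₂)`: a sup entry, a first-difference (gradient) entry and a Hölder entry —
the three slots of the printed window FORMAT `|A|, |∇A|, ‖A‖_{1,β}` ([Balaban1985RegularSpaces] (1.36) p. 82,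
[Balaban1987RG1] (3.31) p. 276), here for an `R`-valued lattice bond field in bond-variable units. -/
@[ext] structure Win where
  /-- the sup entry `b₀` -/
  sup : ℝ
  /-- the first-difference entry `b₁` -/
  grad : ℝ
  /-- the Hölder entry `b₂` (quotients of first differences) -/
  hol : ℝ

/-- [folklore] Strictly positive weights `κ = (κ₀, κ₁, κ₂)` (the scale factors of the three slots). -/
abbrev Win.Pos (κ : Win) : Prop := 0 < κ.sup ∧ 0 < κ.grad ∧ 0 < κ.hol

/-- [folklore] THE WEIGHTED LATTICE WINDOW NORM of a window triple: `N_κ(b) := max(b₀/κ₀, b₁/κ₁, b₂/κ₂)` — so that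
`N_κ(b) ≤ w` says `b₀ ≤ wκ₀ ∧ b₁ ≤ wκ₁ ∧ b₂ ≤ wκ₂` (`winN_le_iff`), the shape of the printed three-slot window
condition with ONE number `w` (α₂-type) and the powers of the scale in `κ` (§6). -/
noncomputable def winN (κ b : Win) : ℝ := max (b.sup / κ.sup) (max (b.grad / κ.grad) (b.hol / κ.hol))

/-- [folklore] The window norm is below `w` iff each slot is below `w` times its weight. -/
theorem winN_le_iff {κ : Win} (hκ : κ.Pos) {b : Win} {w : ℝ} :
    winN κ b ≤ w ↔ b.sup ≤ w * κ.sup ∧ b.grad ≤ w * κ.grad ∧ b.hol ≤ w * κ.hol := by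
  simp only [winN, max_le_iff, div_le_iff₀ hκ.1, div_le_iff₀ hκ.2.1, div_le_iff₀ hκ.2.2]

/-- [folklore] The sup slot is dominated by the window norm (weighted). -/
theorem sup_div_le_winN (κ b : Win) : b.sup / κ.sup ≤ winN κ b := le_max_left _ _

/-- [folklore] The gradient slot is dominated by the window norm (weighted). -/
theorem grad_div_le_winN (κ b : Win) : b.grad / κ.grad ≤ winN κ b :=
  (le_max_left _ _).trans (le_max_right _ _)

/-- [folklore] The Hölder slot is dominated by the window norm (weighted). -/
theorem hol_div_le_winN (κ b : Win) : b.hol / κ.hol ≤ winN κ b :=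
  (le_max_right _ _).trans (le_max_right _ _)

/-- [folklore] `b₀ ≤ N_κ(b)·κ₀`. -/
theorem sup_le_winN_mul {κ : Win} (hκ : κ.Pos) (b : Win) : b.sup ≤ winN κ b * κ.sup :=
  (div_le_iff₀ hκ.1).1 (sup_div_le_winN κ b)

/-- [folklore] `b₁ ≤ N_κ(b)·κ₁`. -/
theorem grad_le_winN_mul {κ : Win} (hκ : κ.Pos) (b : Win) : b.grad ≤ winN κ b * κ.grad :=
  (div_le_iff₀ hκ.2.1).1 (grad_div_le_winN κ b)

/-- [folklore] `b₂ ≤ N_κ(b)·κ₂`. -/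
theorem hol_le_winN_mul {κ : Win} (hκ : κ.Pos) (b : Win) : b.hol ≤ winN κ b * κ.hol :=
  (div_le_iff₀ hκ.2.2).1 (hol_div_le_winN κ b)

/-- [folklore] A window triple with a nonnegative sup entry has nonnegative window norm. -/
theorem winN_nonneg {κ : Win} (hκ : κ.Pos) {b : Win} (hb : 0 ≤ b.sup) : 0 ≤ winN κ b :=
  (div_nonneg hb hκ.1.le).trans (sup_div_le_winN κ b)

/-- [folklore] The window norm is monotone in each slot. -/
theorem winN_mono {κ : Win} (hκ : κ.Pos) {b b' : Win} (h₀ : b.sup ≤ b'.sup) (h₁ : b.grad ≤ b'.grad)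
    (h₂ : b.hol ≤ b'.hol) : winN κ b ≤ winN κ b' :=
  max_le_max (div_le_div_of_nonneg_right h₀ hκ.1.le)
    (max_le_max (div_le_div_of_nonneg_right h₁ hκ.2.1.le) (div_le_div_of_nonneg_right h₂ hκ.2.2.le))

/-- [folklore] If the sup weight is `≤ 1` the window norm dominates the plain sup entry: `b₀ ≤ N_κ(b)` — the
comparison with `T4BlockTransport.latN` (§4). -/
theorem sup_le_winN {κ : Win} (hκ : κ.Pos) (h1 : κ.sup ≤ 1) {b : Win} (hb : 0 ≤ b.sup) : b.sup ≤ winN κ b :=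
  calc b.sup ≤ winN κ b * κ.sup := sup_le_winN_mul hκ b
    _ ≤ winN κ b * 1 := mul_le_mul_of_nonneg_left h1 (winN_nonneg hκ hb)
    _ = winN κ b := mul_one _

/-- [folklore] **LATTICE WINDOW DATA** of an `R`-valued bond field `D` on the block `B(z) = z + {0,…,L−1}^d` with
Hölder exponent `β` and window triple `b = (b₀, b₁, b₂)`: (o) the three entries are nonnegative; (i) SUP: `‖D⟨x,
x+e_ν⟩‖ ≤ b₀` on EVERY bond (global, as in `T4BlockTransport.NDir` — a direction fed to the transport is
zero-extended off the interior of the block); (ii) FIRST DIFFERENCES: `‖(∂_μD)⟨x,x+e_ν⟩‖ ≤ b₁` whenever the sites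
`x, x+e_μ, x+e_μ+e_ν` (hence, by convexity, `x+e_ν`) lie in `B(z)`; (iii) HÖLDER QUOTIENTS OF FIRST DIFFERENCES along
the lattice axes: `‖(∂_μD)(x + m·e_ρ; ν) − (∂_μD)(x; ν)‖ ≤ b₂·m^β` whenever both first differences are interior in
the sense of (ii).  PRINTED FORMAT [Balaban1985BackgroundPropagators] (3.39)–(3.40) p. 397 (`|A|`, `|∇A|`, `‖A‖_{1,α} =
‖∇A‖_α`) with the derivatives there COVARIANT and the Hölder difference PARALLEL-TRANSPORTED along a shortest
contour; HERE plain lattice differences, no transport, axis-parallel pairs only, distances counted in lattice steps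
(HONEST SCOPE of the header). -/
structure WindowData (L : ℕ) (z : Site d) (β : ℝ) (D : Fld d R) (b : Win) : Prop where
  /-- `0 ≤ b₀` -/
  sup_nonneg : 0 ≤ b.sup
  /-- `0 ≤ b₁` -/
  grad_nonneg : 0 ≤ b.grad
  /-- `0 ≤ b₂` -/
  hol_nonneg : 0 ≤ b.hol
  /-- (i) the global sup bound -/
  sup : ∀ x ν, ‖D x ν‖ ≤ b.sup
  /-- (ii) first differences on interior bond pairs -/
  grad : ∀ μ ν x, InBlock L z x → InBlock L z (x + e μ) → InBlock L z (x + e μ + e ν) → ‖fdiff D μ x ν‖ ≤ b.grad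
  /-- (iii) axis-parallel Hölder quotients of first differences -/
  hol : ∀ μ ν ρ x (m : ℕ), InBlock L z x → InBlock L z (x + e μ) → InBlock L z (x + e μ + e ν) →
    InBlock L z (x + m • e ρ) → InBlock L z (x + m • e ρ + e μ) → InBlock L z (x + m • e ρ + e μ + e ν) →
    ‖fdiff D μ (x + m • e ρ) ν - fdiff D μ x ν‖ ≤ b.hol * (m : ℝ) ^ β

/-- [folklore] Window data may be WEAKENED slot-wise. -/
theorem WindowData.mono {L : ℕ} {z : Site d} {β : ℝ} {D : Fld d R} {b b' : Win} (h : WindowData L z β D b)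
    (h₀ : b.sup ≤ b'.sup) (h₁ : b.grad ≤ b'.grad) (h₂ : b.hol ≤ b'.hol) : WindowData L z β D b' where
  sup_nonneg := h.sup_nonneg.trans h₀
  grad_nonneg := h.grad_nonneg.trans h₁
  hol_nonneg := h.hol_nonneg.trans h₂
  sup x ν := (h.sup x ν).trans h₀
  grad μ ν x hx hxμ hxμν := (h.grad μ ν x hx hxμ hxμν).trans h₁
  hol μ ν ρ x m hx hxμ hxμν hx' hx'μ hx'μν :=
    (h.hol μ ν ρ x m hx hxμ hxμν hx' hx'μ hx'μν).trans (mul_le_mul_of_nonneg_right h₂ (by positivity))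

/-- [folklore] THE CRUDE HÖLDER ENTRY FROM THE GRADIENT ENTRY: sup `b₀` and first differences `b₁` give window data
with Hölder entry `2·b₁` for every `β ≥ 0` (two first differences, each `≤ b₁`, and `m^β ≥ 1` for `m ≥ 1`; `m = 0`
is trivial).  HONEST: in the printed scales this entry LOSES a factor `(L^jη)^{−β}`-type against the Hölder slot
(§6 `crude_needs`); the printed-rate entry needs SECOND differences (`WindowData.of_secondDiff`). -/
theorem WindowData.of_grad {L : ℕ} {z : Site d} {β : ℝ} {D : Fld d R} {b₀ b₁ : ℝ} (hβ : 0 ≤ β) (hb₀ : 0 ≤ b₀)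
    (hb₁ : 0 ≤ b₁) (hsup : ∀ x ν, ‖D x ν‖ ≤ b₀)
    (hgrad : ∀ μ ν x, InBlock L z x → InBlock L z (x + e μ) → InBlock L z (x + e μ + e ν) →
      ‖fdiff D μ x ν‖ ≤ b₁) :
    WindowData L z β D ⟨b₀, b₁, 2 * b₁⟩ where
  sup_nonneg := hb₀
  grad_nonneg := hb₁
  hol_nonneg := by positivity
  sup := hsup
  grad := hgrad
  hol μ ν ρ x m hx hxμ hxμν hx' hx'μ hx'μν := by
    rcases Nat.eq_zero_or_pos m with rfl | hm
    · simp only [zero_smul, add_zero, sub_self, norm_zero, Nat.cast_zero]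
      positivity
    · have h1 : (1 : ℝ) ≤ (m : ℝ) ^ β := Real.one_le_rpow (by exact_mod_cast hm) hβ
      calc ‖fdiff D μ (x + m • e ρ) ν - fdiff D μ x ν‖
          ≤ ‖fdiff D μ (x + m • e ρ) ν‖ + ‖fdiff D μ x ν‖ := norm_sub_le _ _
        _ ≤ b₁ + b₁ := add_le_add (hgrad μ ν _ hx' hx'μ hx'μν) (hgrad μ ν x hx hxμ hxμν)
        _ = 2 * b₁ * 1 := by ring
        _ ≤ 2 * b₁ * (m : ℝ) ^ β := mul_le_mul_of_nonneg_left h1 (by positivity)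

/-- [folklore] A FINITE-PATH form of `T4RelativeCombGradient.norm_sub_le_holder`: sup `≤ A` at the sites `0,…,m`
and steps `≤ B` on the `m` edges give `‖f m − f 0‖ ≤ (2A)^{1−β}·B^β·m^β` (`0 ≤ β ≤ 1`). -/
theorem norm_sub_le_holder_fin {M : Type*} [SeminormedAddCommGroup M] (f : ℕ → M) {A B β : ℝ} (m : ℕ)
    (hA : ∀ i ≤ m, ‖f i‖ ≤ A) (hB : ∀ i < m, ‖f (i + 1) - f i‖ ≤ B) (hB0 : 0 ≤ B) (hβ0 : 0 ≤ β) (hβ1 : β ≤ 1) :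
    ‖f m - f 0‖ ≤ (2 * A) ^ (1 - β) * B ^ β * (m : ℝ) ^ β := by
  have H := norm_sub_le_holder (fun i => f (min i m)) (A := A) (B := B)
    (fun i => hA _ (min_le_right i m)) (fun i => ?_) hβ0 hβ1 0 m
  · simpa using H
  · by_cases hi : i < m
    · have e1 : min (i + 1) m = i + 1 := min_eq_left (by omega)
      have e2 : min i m = i := min_eq_left hi.le
      simp only [e1, e2]
      exact hB i hi
    · have e1 : min (i + 1) m = m := min_eq_right (by omega)
      have e2 : min i m = m := min_eq_right (by omega)
      simp only [e1, e2, sub_self, norm_zero]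
      exact hB0

/-- [folklore] THE INTERPOLATED HÖLDER ENTRY FROM SECOND DIFFERENCES: sup `b₀`, first differences `b₁` and a bound
`σ` on the SECOND lattice differences `(∂_ρ∂_μ D)` across interior pairs give window data with Hölder entry
`(2b₁)^{1−β}·σ^β` (`0 ≤ β ≤ 1`): along the axis path `i ↦ (∂_μD)(x + i·e_ρ; ν)`, `i = 0,…,m` (interior by
convexity of the block), `norm_sub_le_holder`.  In the printed scales `b₁ ~ θ²`, `σ ~ θ³` give `b₂ ~ θ^{2+β}`
(§6 `interp_exponent`) — the reason the second-difference datum (the cell's residual (R2), a HYPOTHESIS here,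
cf. [Balaban1985BackgroundPropagators] (3.36)/(3.38) p. 396 for its printed one-configuration format) is what feeds the Hölder
slot at the printed rate. -/
theorem WindowData.of_secondDiff {L : ℕ} {z : Site d} {β : ℝ} {D : Fld d R} {b₀ b₁ σ : ℝ} (hβ0 : 0 ≤ β)
    (hβ1 : β ≤ 1) (hb₀ : 0 ≤ b₀) (hb₁ : 0 ≤ b₁) (hσ : 0 ≤ σ) (hsup : ∀ x ν, ‖D x ν‖ ≤ b₀)
    (hgrad : ∀ μ ν x, InBlock L z x → InBlock L z (x + e μ) → InBlock L z (x + e μ + e ν) →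
      ‖fdiff D μ x ν‖ ≤ b₁)
    (hsec : ∀ μ ν ρ y, InBlock L z y → InBlock L z (y + e μ) → InBlock L z (y + e μ + e ν) →
      InBlock L z (y + e ρ) → InBlock L z (y + e ρ + e μ) → InBlock L z (y + e ρ + e μ + e ν) →
      ‖fdiff D μ (y + e ρ) ν - fdiff D μ y ν‖ ≤ σ) :
    WindowData L z β D ⟨b₀, b₁, (2 * b₁) ^ (1 - β) * σ ^ β⟩ where
  sup_nonneg := hb₀
  grad_nonneg := hb₁
  hol_nonneg := by positivity
  sup := hsup
  grad := hgrad
  hol μ ν ρ x m hx hxμ hxμν hx' hx'μ hx'μν := by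
    -- interior-ness of the three sites of the `i`-th first difference along the axis path, `i ≤ m`
    have hI : ∀ i ≤ m, InBlock L z (x + i • e ρ) ∧ InBlock L z (x + i • e ρ + e μ) ∧
        InBlock L z (x + i • e ρ + e μ + e ν) := by
      intro i hi
      refine ⟨inBlock_add_nsmul_of_le hx hx' hi, ?_, ?_⟩
      · rw [add_nsmul_add_comm]
        rw [add_nsmul_add_comm] at hx'μ
        exact inBlock_add_nsmul_of_le hxμ hx'μ hi
      · rw [add_assoc, add_nsmul_add_comm]
        rw [add_assoc, add_nsmul_add_comm] at hx'μν
        rw [add_assoc] at hxμν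
        exact inBlock_add_nsmul_of_le hxμν hx'μν hi
    have H := norm_sub_le_holder_fin (fun i => fdiff D μ (x + i • e ρ) ν) (A := b₁) (B := σ) m
      (fun i hi => hgrad μ ν _ (hI i hi).1 (hI i hi).2.1 (hI i hi).2.2) (fun i hi => ?_) hσ hβ0 hβ1
    · simpa using H
    · have h0 := hI i hi.le
      have h1 := hI (i + 1) hi
      rw [add_succ_nsmul] at h1 ⊢
      exact hsec μ ν ρ _ h0.1 h0.2.1 h0.2.2 h1.1 h1.2.1 h1.2.2

/-! ## §3  Window directions, the window chart, the zero-extended block deviation, THE WINDOW TRANSPORT THEOREM -/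

/-- [folklore] WINDOW DIRECTIONS on the block `B(z)` with exponent `β`: a bond field TOGETHER WITH declared window
data — the direction type over which the birth slice hypothesis of `T4BirthChartTransport.BirthSlice` is asked
when its abstract window-norm slot `N` is read as the weighted lattice window norm `wN` (today's consumer
`T4BlockTransport.NDir`/`latN` declares the SUP slot only). -/
def WDir (d : ℕ) (R : Type*) [NormedRing R] (L : ℕ) (z : Site d) (β : ℝ) : Type _ :=
  {p : Fld d R × Win // WindowData L z β p.1 p.2}

/-- [folklore] THE WINDOW NORM of a window direction: the weighted window norm of its declared triple. -/
noncomputable def wN (L : ℕ) (z : Site d) (β : ℝ) (κ : Win) (p : WDir d R L z β) : ℝ := winN κ p.1.2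

section Chart

variable [NormedAlgebra ℂ R]

/-- [folklore] THE WINDOW CHART: the SAME affine lattice chart `t ↦ U + t·D` as `T4BlockTransport.latMove`, along a
window direction. -/
def wMove (L : ℕ) (z : Site d) (β : ℝ) (U : Fld d R) (p : WDir d R L z β) (t : ℂ) : Fld d R :=
  fun x ν => U x ν + t • p.1.1 x ν

/-- [folklore] The window chart starts at the base. -/
theorem wMove_zero (L : ℕ) (z : Site d) (β : ℝ) (U : Fld d R) (p : WDir d R L z β) : wMove L z β U p 0 = U := by
  funext x ν; simp [wMove]

/-- [folklore] The window chart at `t = 1` is `U + D`. -/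
theorem wMove_one_apply (L : ℕ) (z : Site d) (β : ℝ) (U : Fld d R) (p : WDir d R L z β) (x : Site d) (ν : Fin d) :
    wMove L z β U p 1 x ν = U x ν + p.1.1 x ν := by
  simp [wMove]

end Chart

section Dev

variable {L : ℕ} {z : Site d}

open Classical in
/-- [folklore] THE ZERO-EXTENDED BLOCK DEVIATION of `U₁^g` from `U₀`: `(U₁^g)⟨b⟩ − U₀⟨b⟩` on the interior bonds `b` of
`B(z)`, `0` elsewhere — the direction that `T4BlockTransport.block_transport` feeds to the chart (there a local
`let`; named here because the window data is a hypothesis ABOUT it). -/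
noncomputable def blockDev (L : ℕ) (z : Site d) (g : Site d → Rˣ) (U₀ U₁ : Cfg d R) : Fld d R := fun x ν =>
  if InBlock L z x ∧ InBlock L z (x + e ν) then (gaugeAct g U₁ x ν : R) - U₀ x ν else 0

/-- [folklore] On an interior bond the block deviation is the deviation. -/
theorem blockDev_of_inBlock (g : Site d → Rˣ) (U₀ U₁ : Cfg d R) {x : Site d} {ν : Fin d} (hx : InBlock L z x)
    (hxν : InBlock L z (x + e ν)) : blockDev L z g U₀ U₁ x ν = (gaugeAct g U₁ x ν : R) - U₀ x ν := by
  classical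
  simp only [blockDev, if_pos (And.intro hx hxν)]

/-- [folklore] Off the interior the block deviation vanishes. -/
theorem blockDev_of_not (g : Site d → Rˣ) (U₀ U₁ : Cfg d R) {x : Site d} {ν : Fin d}
    (h : ¬ (InBlock L z x ∧ InBlock L z (x + e ν))) : blockDev L z g U₀ U₁ x ν = 0 := by
  classical
  simp only [blockDev, if_neg h]

/-- [folklore] The interior deviation FACTORISES through the transverse defect `W = (U₁^g)·U₀⁻¹`:
`(U₁^g)⟨b⟩ − U₀⟨b⟩ = (W⟨b⟩ − 1)·U₀⟨b⟩`. -/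
theorem gaugeAct_sub_eq (g : Site d → Rˣ) (U₀ U₁ : Cfg d R) (x : Site d) (ν : Fin d) :
    (gaugeAct g U₁ x ν : R) - U₀ x ν = (((gaugeAct g U₁ x ν * (U₀ x ν)⁻¹ : Rˣ) : R) - 1) * (U₀ x ν : R) := by
  rw [sub_mul, one_mul, Units.val_mul, Units.inv_mul_cancel_right]

/-- [folklore] … in the comb gauge: `(U₁^g)⟨b⟩ − U₀⟨b⟩ = (W⟨b⟩ − 1)·U₀⟨b⟩` with `W = T4RelativeComb.defect`. -/
theorem dev_eq_defect (U₀ U₁ : Cfg d R) (z x : Site d) (ν : Fin d) :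
    (gaugeAct (combGauge U₀ U₁ z) U₁ x ν : R) - U₀ x ν = ((defect U₀ U₁ z x ν : R) - 1) * (U₀ x ν : R) :=
  gaugeAct_sub_eq _ _ _ _ _

/-- [folklore] The trivial pair in the trivial gauge has zero block deviation. -/
theorem blockDev_self_one (L : ℕ) (z : Site d) (U : Cfg d R) : blockDev L z (fun _ => 1) U U = 0 := by
  classical
  funext x ν
  simp [blockDev, gaugeAct]

end Dev

section Transport

variable [NormedAlgebra ℂ R] {F : Type*} [NormedAddCommGroup F] [NormedSpace ℂ F] [CompleteSpace F]
variable {Fn : Fld d R → F} {𝒦 : Set (Fld d R)} {w r A : ℝ} {L : ℕ} {z : Site d} {β : ℝ} {κ : Win}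

/-- **THE WINDOW TRANSPORT THEOREM (∀ block gauge; the `N`-slot of the birth slice read as the lattice window
norm).**  A block functional `Fn` invariant under the block gauge relation of `B(z)` and obeying a birth slice of
radius `r`, sup `A`, window `w` ALONG WINDOW DIRECTIONS — i.e. the slice hypothesis is asked only for directions
carrying (sup, first-difference, Hölder) window data, measured by the weighted window norm `N_κ` —, a base `U₀` in
the regular set `𝒦`, ANY configuration `U₁` and ANY unitary-like gauge `g` whose zero-extended block deviation
`(U₁^g − U₀)|_{B(z)}` has window data `b` with `N_κ(b) ≤ w`: `‖Fn U₁ − Fn U₀‖ ≤ (4A/r)·N_κ(b)`.  Same mechanism as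
`T4BlockTransport.block_transport` (`T4BirthChartTransport.transport_of_birthChart` with the relative-gauge witness
= the window direction; `N_κ(b) = 0` forces `b₀ = 0`, a block-gauge related pair, difference `0`); what is NEW is
only that the chain now CONSUMES a first-difference / Hölder window.  Every analytic input is a hypothesis.
[folklore] -/
theorem block_transport_window (hinv : GaugeInvariant (BlockRel L z) Fn)
    (hsl : BirthSlice Fn (wMove L z β) (wN L z β κ) 𝒦 w r A) (hκ : κ.Pos) (hr : 0 < r) (hA : 0 ≤ A)
    {U₀ U₁ : Cfg d R} (hU₀ : val U₀ ∈ 𝒦) {g : Site d → Rˣ} (hg : ∀ x, UnitaryLike (g x)) {b : Win}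
    (hW : WindowData L z β (blockDev L z g U₀ U₁) b) (hbw : winN κ b ≤ w) :
    ‖Fn (val U₁) - Fn (val U₀)‖ ≤ 4 * A / r * winN κ b := by
  rcases (winN_nonneg hκ hW.sup_nonneg).eq_or_lt with h0 | hpos
  · have hsup0 : b.sup ≤ 0 := by
      have h := sup_le_winN_mul hκ b
      rw [← h0, zero_mul] at h
      exact h
    have hrel : BlockRel L z (val U₁) (val U₀) := by
      refine ⟨g, hg, fun x ν hx hxν => ?_⟩
      have h := hW.sup x ν
      rw [blockDev_of_inBlock g U₀ U₁ hx hxν] at h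
      have h' : ‖(gaugeAct g U₁ x ν : R) - U₀ x ν‖ ≤ 0 := h.trans hsup0
      rw [norm_le_zero_iff, sub_eq_zero] at h'
      rw [val_apply, ← h']
      simp [gaugeAct]
    rw [sub_eq_zero_of_rel hinv hrel, norm_zero, ← h0, mul_zero]
  · let dir : WDir d R L z β := ⟨(blockDev L z g U₀ U₁, b), hW⟩
    have hrel : BlockRel L z (val U₁) (wMove L z β (val U₀) dir 1) := by
      refine ⟨g, hg, fun x ν hx hxν => ?_⟩
      rw [wMove_one_apply, val_apply]
      show (U₀ x ν : R) + blockDev L z g U₀ U₁ x ν = _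
      rw [blockDev_of_inBlock g U₀ U₁ hx hxν]
      simp only [gaugeAct, Units.val_mul, val_apply]
      abel
    exact transport_of_birthChart hinv hsl (wMove_zero L z β) hr hA hU₀ ⟨dir, hpos, le_rfl, hrel⟩ hbw

end Transport

/-! ## §4  Comparison with the sup-slot consumer `T4BlockTransport.latN`: the window slice is the WEAKER hypothesis -/

section Compare

variable {L : ℕ} {z : Site d} {β : ℝ} {κ : Win}

/-- [folklore] A window direction IS a sup direction of `T4BlockTransport` with declared bound its window norm, as
soon as the sup weight is `≤ 1` (`b₀ ≤ N_κ(b)`). -/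
noncomputable def toNDir (hκ : κ.Pos) (h1 : κ.sup ≤ 1) (p : WDir d R L z β) : NDir d R :=
  ⟨(p.1.1, wN L z β κ p), fun x ν => (p.2.sup x ν).trans (sup_le_winN hκ h1 p.2.sup_nonneg)⟩

/-- [folklore] … with the same declared size … -/
theorem latN_toNDir (hκ : κ.Pos) (h1 : κ.sup ≤ 1) (p : WDir d R L z β) :
    latN (toNDir hκ h1 p) = wN L z β κ p := rfl

/-- [folklore] … and the same chart. -/
theorem latMove_toNDir [NormedAlgebra ℂ R] (hκ : κ.Pos) (h1 : κ.sup ≤ 1) (U : Fld d R) (p : WDir d R L z β) :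
    latMove U (toNDir hκ h1 p) = wMove L z β U p := rfl

variable [NormedAlgebra ℂ R] {F : Type*} [NormedAddCommGroup F] [NormedSpace ℂ F] [CompleteSpace F]
variable {Fn : Fld d R → F} {𝒦 : Set (Fld d R)} {w r A : ℝ}

omit [CompleteSpace F] in
/-- **THE SEAM COMPARISON.**  Today's consumer hypothesis — a birth slice along EVERY direction of declared sup `≤ w`
(`T4BlockTransport`: `BirthSlice Fn latMove latN`) — IMPLIES the window slice hypothesis of this file (sup weight
`κ₀ ≤ 1`): the window slice asks analyticity only along directions whose sup AND first differences AND Hölder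
quotients are inside the window, which is the FORMAT in which print grants it ([Balaban1987RG1] (3.14) p. 272,
(3.31) p. 276: "analytic in 𝐀, for 𝐀 satisfying the conditions |𝐀|, |P₁𝐀|, |∇^ξ_U𝐀|, |Δ^ξ_U𝐀| < α₂").  The
converse implication is NOT claimed (and not expected). [folklore] -/
theorem birthSlice_window_of_sup (hκ : κ.Pos) (h1 : κ.sup ≤ 1) (hsl : BirthSlice Fn latMove latN 𝒦 w r A) :
    BirthSlice Fn (wMove L z β) (wN L z β κ) 𝒦 w r A :=
  fun U hU p hp hpw => hsl U hU (toNDir hκ h1 p) hp hpw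

end Compare

/-! ## §5  Feeding the window from the comb lineage: sup (`T4RelativeComb`), first differences
(`T4RelativeCombGradient`), crude / declared-second-difference Hölder entry; the end-to-end corollaries -/

section Feed

variable [NormOneClass R] {L : ℕ} {z : Site d}

/-- [folklore] THE SUP ENTRY of the comb defect deviation on an interior bond: `‖(U₁^g)⟨b⟩ − U₀⟨b⟩‖ ≤ C·s` with
`C = (d−1)(L−1)`, `s` = the block sup of the GAUGE-FIXED relative plaquette deviation, `g` = the relative comb gauge
(`T4RelativeComb.norm_defect_sub_one_le_ladderLen`, `ladderLen_le`, `‖U₀⟨b⟩‖ ≤ 1`). -/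
theorem norm_dev_le {U₀ U₁ : Cfg d R} {s : ℝ} (hU₀ : ∀ x ν, UnitaryLike (U₀ x ν))
    (hU₁ : ∀ x ν, UnitaryLike (U₁ x ν))
    (hs : PlaqSup L z (fun y ρ ν =>
      ‖(plaq (gaugeAct (combGauge U₀ U₁ z) U₁) y ρ ν : R) - plaq U₀ y ρ ν‖) s) (hs0 : 0 ≤ s)
    {x : Site d} {ν : Fin d} (hx : InBlock L z x) (hxν : InBlock L z (x + e ν)) :
    ‖(gaugeAct (combGauge U₀ U₁ z) U₁ x ν : R) - U₀ x ν‖ ≤ ((d : ℝ) - 1) * ((L : ℝ) - 1) * s := by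
  have hW : ‖(defect U₀ U₁ z x ν : R) - 1‖ ≤ ((d : ℝ) - 1) * ((L : ℝ) - 1) * s := by
    obtain ⟨k, hk, rfl⟩ := exists_offset_of_inBlock hx
    have hν : k ν + 1 < L := by
      rw [← site_add_single, inBlock_site_iff] at hxν
      simpa using hxν ν
    calc _ ≤ (ladderLen k ν : ℝ) * s := norm_defect_sub_one_le_ladderLen hU₀ hU₁ hs k hk ν hν
      _ ≤ _ := mul_le_mul_of_nonneg_right (ladderLen_le hk ν) hs0
  rw [dev_eq_defect]
  calc _ ≤ ‖(defect U₀ U₁ z x ν : R) - 1‖ * ‖(U₀ x ν : R)‖ := norm_mul_le _ _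
    _ ≤ ((d : ℝ) - 1) * ((L : ℝ) - 1) * s * 1 :=
        mul_le_mul hW (hU₀ x ν).1 (norm_nonneg _) ((norm_nonneg _).trans hW)
    _ = _ := mul_one _

/-- [folklore] THE FIRST-DIFFERENCE ENTRY of the comb defect deviation on an interior bond pair, from a bound `G` on
the first difference of the transverse defect `W` (the datum `T4RelativeCombGradient.norm_gradient_le` /
`norm_gradient_le_raw` supply) and the base bond gradient `γU`:
`(W′−1)U₀′ − (W−1)U₀ = (W′−W)·U₀′ + (W−1)·(U₀′−U₀)`, so `‖∂_μ((U₁^g) − U₀)‖ ≤ G + C·s·γU`. -/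
theorem norm_fdiff_dev_le {U₀ U₁ : Cfg d R} {s G γU : ℝ} (hU₀ : ∀ x ν, UnitaryLike (U₀ x ν))
    (hU₁ : ∀ x ν, UnitaryLike (U₁ x ν))
    (hs : PlaqSup L z (fun y ρ ν =>
      ‖(plaq (gaugeAct (combGauge U₀ U₁ z) U₁) y ρ ν : R) - plaq U₀ y ρ ν‖) s) (hs0 : 0 ≤ s)
    {μ ν : Fin d} {x : Site d} (hx : InBlock L z x) (hxμ : InBlock L z (x + e μ))
    (hxμν : InBlock L z (x + e μ + e ν))
    (hG : ‖(defect U₀ U₁ z (x + e μ) ν : R) - defect U₀ U₁ z x ν‖ ≤ G)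
    (hγU : ‖(U₀ (x + e μ) ν : R) - U₀ x ν‖ ≤ γU) :
    ‖fdiff (blockDev L z (combGauge U₀ U₁ z) U₀ U₁) μ x ν‖ ≤ G + ((d : ℝ) - 1) * ((L : ℝ) - 1) * s * γU := by
  have hxν : InBlock L z (x + e ν) := inBlock_add_of_add_add hx hxμν
  have hW : ‖(defect U₀ U₁ z x ν : R) - 1‖ ≤ ((d : ℝ) - 1) * ((L : ℝ) - 1) * s := by
    obtain ⟨k, hk, rfl⟩ := exists_offset_of_inBlock hx
    have hν' : k ν + 1 < L := by
      rw [← site_add_single, inBlock_site_iff] at hxν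
      simpa using hxν ν
    calc _ ≤ (ladderLen k ν : ℝ) * s := norm_defect_sub_one_le_ladderLen hU₀ hU₁ hs k hk ν hν'
      _ ≤ _ := mul_le_mul_of_nonneg_right (ladderLen_le hk ν) hs0
  rw [fdiff_apply, blockDev_of_inBlock _ _ _ hxμ hxμν, blockDev_of_inBlock _ _ _ hx hxν, dev_eq_defect,
    dev_eq_defect]
  set W' : R := ((defect U₀ U₁ z (x + e μ) ν : Rˣ) : R)
  set W : R := ((defect U₀ U₁ z x ν : Rˣ) : R)
  have e1 : (W' - 1) * (U₀ (x + e μ) ν : R) - (W - 1) * (U₀ x ν : R) =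
      (W' - W) * (U₀ (x + e μ) ν : R) + (W - 1) * ((U₀ (x + e μ) ν : R) - U₀ x ν) := by
    noncomm_ring
  rw [e1]
  have hG' : ‖W' - W‖ ≤ G := hG
  have hW' : ‖W - 1‖ ≤ ((d : ℝ) - 1) * ((L : ℝ) - 1) * s := hW
  calc _ ≤ ‖(W' - W) * (U₀ (x + e μ) ν : R)‖ + ‖(W - 1) * ((U₀ (x + e μ) ν : R) - U₀ x ν)‖ := norm_add_le _ _
    _ ≤ ‖W' - W‖ * ‖(U₀ (x + e μ) ν : R)‖ + ‖W - 1‖ * ‖(U₀ (x + e μ) ν : R) - U₀ x ν‖ :=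
        add_le_add (norm_mul_le _ _) (norm_mul_le _ _)
    _ ≤ G * 1 + ((d : ℝ) - 1) * ((L : ℝ) - 1) * s * γU :=
        add_le_add (mul_le_mul hG' (hU₀ _ _).1 (norm_nonneg _) ((norm_nonneg _).trans hG'))
          (mul_le_mul hW' hγU (norm_nonneg _) ((norm_nonneg _).trans hW'))
    _ = _ := by rw [mul_one]

/-- **WINDOW DATA OF THE COMB DEFECT DEVIATION** (crude Hölder entry).  For a unitary-like pair on `B(z)` with
GAUGE-FIXED relative plaquette deviation `≤ s`, a bound `G` on the first differences of the transverse defect `W`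
over interior bond pairs (all directions `μ`) and base bond gradient `≤ γU`, the zero-extended block deviation
`(U₁^g − U₀)|_{B(z)}` (`g` = the relative comb gauge) has window data `(C·s, G + C·s·γU, 2(G + C·s·γU))`,
`C = (d−1)(L−1)`, for every `β ≥ 0`.  The inputs are HYPOTHESES; `G` is discharged from block sup data in
`windowData_comb_raw`. [folklore] -/
theorem windowData_comb {U₀ U₁ : Cfg d R} {β s G γU : ℝ} (hβ : 0 ≤ β)
    (hC : 0 ≤ ((d : ℝ) - 1) * ((L : ℝ) - 1))
    (hU₀ : ∀ x ν, UnitaryLike (U₀ x ν)) (hU₁ : ∀ x ν, UnitaryLike (U₁ x ν))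
    (hs : PlaqSup L z (fun y ρ ν =>
      ‖(plaq (gaugeAct (combGauge U₀ U₁ z) U₁) y ρ ν : R) - plaq U₀ y ρ ν‖) s) (hs0 : 0 ≤ s)
    (hG : ∀ μ ν x, InBlock L z x → InBlock L z (x + e μ) → InBlock L z (x + e μ + e ν) →
      ‖(defect U₀ U₁ z (x + e μ) ν : R) - defect U₀ U₁ z x ν‖ ≤ G) (hG0 : 0 ≤ G)
    (hγU : ∀ μ x ρ, InBlock L z x → InBlock L z (x + e ρ) → InBlock L z (x + e μ) →
      InBlock L z (x + e μ + e ρ) → ‖(U₀ (x + e μ) ρ : R) - U₀ x ρ‖ ≤ γU) (hγU0 : 0 ≤ γU) :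
    WindowData L z β (blockDev L z (combGauge U₀ U₁ z) U₀ U₁)
      ⟨((d : ℝ) - 1) * ((L : ℝ) - 1) * s, G + ((d : ℝ) - 1) * ((L : ℝ) - 1) * s * γU,
        2 * (G + ((d : ℝ) - 1) * ((L : ℝ) - 1) * s * γU)⟩ := by
  refine WindowData.of_grad hβ (by positivity) (by positivity) (fun x ν => ?_) (fun μ ν x hx hxμ hxμν => ?_)
  · by_cases h : InBlock L z x ∧ InBlock L z (x + e ν)
    · rw [blockDev_of_inBlock _ _ _ h.1 h.2]; exact norm_dev_le hU₀ hU₁ hs hs0 h.1 h.2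
    · rw [blockDev_of_not _ _ _ h, norm_zero]; positivity
  · exact norm_fdiff_dev_le hU₀ hU₁ hs hs0 hx hxμ hxμν (hG μ ν x hx hxμ hxμν)
      (hγU μ x ν hx (inBlock_add_of_add_add hx hxμν) hxμ hxμν)

/-- [folklore] THE GRADIENT BOUND of `T4RelativeCombGradient.norm_gradient_le_raw`, named: `G_raw(d, L; s, q₀, q₁,
τ₀, τ₁, γU, γ₀, γ₁)`. -/
def gradRaw (d L : ℕ) (s q₀ q₁ τ₀ τ₁ γU γ₀ γ₁ : ℝ) : ℝ :=
  s * (1 + ((d : ℝ) - 1) * ((L : ℝ) - 1) * (2 * q₀ + s + 2 * τ₀)) +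
    ((d : ℝ) - 1) * ((L : ℝ) - 1) *
      (2 * γU * (((d : ℝ) - 1) * ((L : ℝ) - 1) * s + s) +
        (γ₁ + γ₀ + 2 * q₁ * (τ₀ + ((d : ℝ) - 1) * ((L : ℝ) - 1) * s + τ₁)) +
        γ₀ * (2 * (((d : ℝ) - 1) * ((L : ℝ) - 1) * s) + s))

/-- [folklore] `G_raw ≥ 0` for nonnegative data and `C ≥ 0`. -/
theorem gradRaw_nonneg {d L : ℕ} {s q₀ q₁ τ₀ τ₁ γU γ₀ γ₁ : ℝ} (hC : 0 ≤ ((d : ℝ) - 1) * ((L : ℝ) - 1))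
    (hs0 : 0 ≤ s) (hq0 : 0 ≤ q₀) (hq1 : 0 ≤ q₁) (hτ0 : 0 ≤ τ₀) (hτ1 : 0 ≤ τ₁) (hγU0 : 0 ≤ γU)
    (hγ00 : 0 ≤ γ₀) (hγ10 : 0 ≤ γ₁) : 0 ≤ gradRaw d L s q₀ q₁ τ₀ τ₁ γU γ₀ γ₁ := by
  unfold gradRaw; positivity

/-- **WINDOW DATA OF THE COMB DEFECT DEVIATION FROM BLOCK SUP DATA** (the gradient datum DISCHARGED by
`T4RelativeCombGradient.norm_gradient_le_raw`): unitary-like pair, gauge-fixed relative plaquette deviation `≤ s`,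
curvatures `≤ q₀, q₁`, bond deviations from `1` `≤ τ₀, τ₁`, base bond gradient `≤ γU`, raw plaquette gradients
`≤ γ₀, γ₁` (all directions `μ`) on `B(z)` ⟹ window data `(C·s, G_raw + C·s·γU, 2(G_raw + C·s·γU))` for every
`β ≥ 0`.  FIRST ORDER in the small data; crude Hölder entry (HONEST: loses `θ^β` against the printed slot, §6).
[folklore] -/
theorem windowData_comb_raw {U₀ U₁ : Cfg d R} {β s q₀ q₁ τ₀ τ₁ γU γ₀ γ₁ : ℝ} (hβ : 0 ≤ β)
    (hC : 0 ≤ ((d : ℝ) - 1) * ((L : ℝ) - 1))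
    (hU₀ : ∀ x ν, UnitaryLike (U₀ x ν)) (hU₁ : ∀ x ν, UnitaryLike (U₁ x ν))
    (hs : PlaqSup L z (fun y ρ ν =>
      ‖(plaq (gaugeAct (combGauge U₀ U₁ z) U₁) y ρ ν : R) - plaq U₀ y ρ ν‖) s)
    (hq₀ : PlaqSup L z (fun y ρ ν => ‖(plaq U₀ y ρ ν : R) - 1‖) q₀)
    (hq₁ : PlaqSup L z (fun y ρ ν => ‖(plaq U₁ y ρ ν : R) - 1‖) q₁)
    (hτ₀ : ∀ x ρ, InBlock L z x → InBlock L z (x + e ρ) → ‖(U₀ x ρ : R) - 1‖ ≤ τ₀)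
    (hτ₁ : ∀ x ρ, InBlock L z x → InBlock L z (x + e ρ) → ‖(U₁ x ρ : R) - 1‖ ≤ τ₁)
    (hγU : ∀ μ x ρ, InBlock L z x → InBlock L z (x + e ρ) → InBlock L z (x + e μ) →
      InBlock L z (x + e μ + e ρ) → ‖(U₀ (x + e μ) ρ : R) - U₀ x ρ‖ ≤ γU)
    (hγ₀ : ∀ μ y ρ ν', ρ ≠ ν' → InBlock L z y → InBlock L z (y + e ρ) → InBlock L z (y + e ν') →
      InBlock L z (y + e ρ + e ν') → InBlock L z (y + e μ) → InBlock L z (y + e μ + e ρ) →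
      InBlock L z (y + e μ + e ν') → InBlock L z (y + e μ + e ρ + e ν') →
      ‖(plaq U₀ (y + e μ) ρ ν' : R) - plaq U₀ y ρ ν'‖ ≤ γ₀)
    (hγ₁ : ∀ μ y ρ ν', ρ ≠ ν' → InBlock L z y → InBlock L z (y + e ρ) → InBlock L z (y + e ν') →
      InBlock L z (y + e ρ + e ν') → InBlock L z (y + e μ) → InBlock L z (y + e μ + e ρ) →
      InBlock L z (y + e μ + e ν') → InBlock L z (y + e μ + e ρ + e ν') →
      ‖(plaq U₁ (y + e μ) ρ ν' : R) - plaq U₁ y ρ ν'‖ ≤ γ₁)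
    (hs0 : 0 ≤ s) (hq0 : 0 ≤ q₀) (hq1 : 0 ≤ q₁) (hτ0 : 0 ≤ τ₀) (hτ1 : 0 ≤ τ₁) (hγU0 : 0 ≤ γU)
    (hγ00 : 0 ≤ γ₀) (hγ10 : 0 ≤ γ₁) :
    WindowData L z β (blockDev L z (combGauge U₀ U₁ z) U₀ U₁)
      ⟨((d : ℝ) - 1) * ((L : ℝ) - 1) * s,
        gradRaw d L s q₀ q₁ τ₀ τ₁ γU γ₀ γ₁ + ((d : ℝ) - 1) * ((L : ℝ) - 1) * s * γU,
        2 * (gradRaw d L s q₀ q₁ τ₀ τ₁ γU γ₀ γ₁ + ((d : ℝ) - 1) * ((L : ℝ) - 1) * s * γU)⟩ :=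
  windowData_comb hβ hC hU₀ hU₁ hs hs0
    (fun μ ν x hx hxμ hxμν => norm_gradient_le_raw (μ := μ) (ν := ν) hU₀ hU₁ hs hq₀ hq₁ hτ₀ hτ₁ (hγU μ) (hγ₀ μ)
      (hγ₁ μ) hs0 hq0 hq1 hτ0 hτ1 hγU0 hγ00 hγ10 x hx hxμ hxμν)
    (gradRaw_nonneg hC hs0 hq0 hq1 hτ0 hτ1 hγU0 hγ00 hγ10) hγU hγU0

/-- [folklore] WINDOW DATA OF THE COMB DEFECT DEVIATION WITH A DECLARED SECOND-DIFFERENCE DATUM `σ` (the residual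
(R2) of the cell's gap record — NOT supplied by the comb lineage, a HYPOTHESIS): Hölder entry `(2(G + C·s·γU))^{1−β}
·σ^β` by interpolation (`WindowData.of_secondDiff`), `0 ≤ β ≤ 1`. -/
theorem windowData_comb_secondDiff {U₀ U₁ : Cfg d R} {β s G γU σ : ℝ} (hβ0 : 0 ≤ β) (hβ1 : β ≤ 1)
    (hC : 0 ≤ ((d : ℝ) - 1) * ((L : ℝ) - 1))
    (hU₀ : ∀ x ν, UnitaryLike (U₀ x ν)) (hU₁ : ∀ x ν, UnitaryLike (U₁ x ν))
    (hs : PlaqSup L z (fun y ρ ν =>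
      ‖(plaq (gaugeAct (combGauge U₀ U₁ z) U₁) y ρ ν : R) - plaq U₀ y ρ ν‖) s) (hs0 : 0 ≤ s)
    (hG : ∀ μ ν x, InBlock L z x → InBlock L z (x + e μ) → InBlock L z (x + e μ + e ν) →
      ‖(defect U₀ U₁ z (x + e μ) ν : R) - defect U₀ U₁ z x ν‖ ≤ G) (hG0 : 0 ≤ G)
    (hγU : ∀ μ x ρ, InBlock L z x → InBlock L z (x + e ρ) → InBlock L z (x + e μ) →
      InBlock L z (x + e μ + e ρ) → ‖(U₀ (x + e μ) ρ : R) - U₀ x ρ‖ ≤ γU) (hγU0 : 0 ≤ γU)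
    (hσ0 : 0 ≤ σ)
    (hσ : ∀ μ ν ρ y, InBlock L z y → InBlock L z (y + e μ) → InBlock L z (y + e μ + e ν) →
      InBlock L z (y + e ρ) → InBlock L z (y + e ρ + e μ) → InBlock L z (y + e ρ + e μ + e ν) →
      ‖fdiff (blockDev L z (combGauge U₀ U₁ z) U₀ U₁) μ (y + e ρ) ν -
        fdiff (blockDev L z (combGauge U₀ U₁ z) U₀ U₁) μ y ν‖ ≤ σ) :
    WindowData L z β (blockDev L z (combGauge U₀ U₁ z) U₀ U₁)
      ⟨((d : ℝ) - 1) * ((L : ℝ) - 1) * s, G + ((d : ℝ) - 1) * ((L : ℝ) - 1) * s * γU,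
        (2 * (G + ((d : ℝ) - 1) * ((L : ℝ) - 1) * s * γU)) ^ (1 - β) * σ ^ β⟩ := by
  have hW := windowData_comb hβ0 hC hU₀ hU₁ hs hs0 hG hG0 hγU hγU0
  exact WindowData.of_secondDiff hβ0 hβ1 hW.sup_nonneg hW.grad_nonneg hσ0 hW.sup hW.grad hσ

variable [NormedAlgebra ℂ R] {F : Type*} [NormedAddCommGroup F] [NormedSpace ℂ F] [CompleteSpace F]
variable {Fn : Fld d R → F} {𝒦 : Set (Fld d R)} {w r A : ℝ} {β : ℝ} {κ : Win}

/-- **THE COMB INSTANCE OF THE WINDOW TRANSPORT** (`g` := the relative comb gauge, BY NAME): gauge-invariant `Fn`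
with a WINDOW birth slice, unitary-like `U₀ ∈ 𝒦`, `U₁`, gauge-fixed relative plaquette deviation `≤ s`, defect
gradient datum `G`, base bond gradient `γU`, and the resulting window triple `b = (C·s, G + C·s·γU, 2(G + C·s·γU))`
inside the window `N_κ(b) ≤ w` ⟹ `‖Fn U₁ − Fn U₀‖ ≤ (4A/r)·N_κ(b)`.  [folklore] -/
theorem block_transport_comb_window (hinv : GaugeInvariant (BlockRel L z) Fn)
    (hsl : BirthSlice Fn (wMove L z β) (wN L z β κ) 𝒦 w r A) (hκ : κ.Pos) (hr : 0 < r) (hA : 0 ≤ A)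
    {U₀ U₁ : Cfg d R} (hU₀𝒦 : val U₀ ∈ 𝒦) {s G γU : ℝ} (hβ : 0 ≤ β)
    (hC : 0 ≤ ((d : ℝ) - 1) * ((L : ℝ) - 1))
    (hU₀ : ∀ x ν, UnitaryLike (U₀ x ν)) (hU₁ : ∀ x ν, UnitaryLike (U₁ x ν))
    (hs : PlaqSup L z (fun y ρ ν =>
      ‖(plaq (gaugeAct (combGauge U₀ U₁ z) U₁) y ρ ν : R) - plaq U₀ y ρ ν‖) s) (hs0 : 0 ≤ s)
    (hG : ∀ μ ν x, InBlock L z x → InBlock L z (x + e μ) → InBlock L z (x + e μ + e ν) →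
      ‖(defect U₀ U₁ z (x + e μ) ν : R) - defect U₀ U₁ z x ν‖ ≤ G) (hG0 : 0 ≤ G)
    (hγU : ∀ μ x ρ, InBlock L z x → InBlock L z (x + e ρ) → InBlock L z (x + e μ) →
      InBlock L z (x + e μ + e ρ) → ‖(U₀ (x + e μ) ρ : R) - U₀ x ρ‖ ≤ γU) (hγU0 : 0 ≤ γU)
    (hbw : winN κ ⟨((d : ℝ) - 1) * ((L : ℝ) - 1) * s, G + ((d : ℝ) - 1) * ((L : ℝ) - 1) * s * γU,
        2 * (G + ((d : ℝ) - 1) * ((L : ℝ) - 1) * s * γU)⟩ ≤ w) :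
    ‖Fn (val U₁) - Fn (val U₀)‖ ≤ 4 * A / r *
      winN κ ⟨((d : ℝ) - 1) * ((L : ℝ) - 1) * s, G + ((d : ℝ) - 1) * ((L : ℝ) - 1) * s * γU,
        2 * (G + ((d : ℝ) - 1) * ((L : ℝ) - 1) * s * γU)⟩ :=
  block_transport_window hinv hsl hκ hr hA hU₀𝒦 (unitaryLike_combGauge hU₀ hU₁ z)
    (windowData_comb hβ hC hU₀ hU₁ hs hs0 hG hG0 hγU hγU0) hbw

/-- **THE COMB INSTANCE FROM BLOCK SUP DATA, END TO END** (the gradient datum discharged by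
`T4RelativeCombGradient.norm_gradient_le_raw`): gauge-invariant `Fn` with a WINDOW birth slice, unitary-like
`U₀ ∈ 𝒦`, `U₁` with gauge-fixed relative plaquette deviation `≤ s`, curvatures `≤ q₀, q₁`, bond deviations `≤ τ₀,
τ₁`, base bond gradient `≤ γU`, raw plaquette gradients `≤ γ₀, γ₁` on `B(z)`, and the resulting window triple
`b = (C·s, G_raw + C·s·γU, 2(G_raw + C·s·γU))` inside the window ⟹ `‖Fn U₁ − Fn U₀‖ ≤ (4A/r)·N_κ(b)` — a
FIRST-DIFFERENCE window CONSUMED by the transport chain (crude Hölder entry; §6 for its cost). [folklore] -/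
theorem block_transport_comb_window_raw (hinv : GaugeInvariant (BlockRel L z) Fn)
    (hsl : BirthSlice Fn (wMove L z β) (wN L z β κ) 𝒦 w r A) (hκ : κ.Pos) (hr : 0 < r) (hA : 0 ≤ A)
    {U₀ U₁ : Cfg d R} (hU₀𝒦 : val U₀ ∈ 𝒦) {s q₀ q₁ τ₀ τ₁ γU γ₀ γ₁ : ℝ} (hβ : 0 ≤ β)
    (hC : 0 ≤ ((d : ℝ) - 1) * ((L : ℝ) - 1))
    (hU₀ : ∀ x ν, UnitaryLike (U₀ x ν)) (hU₁ : ∀ x ν, UnitaryLike (U₁ x ν))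
    (hs : PlaqSup L z (fun y ρ ν =>
      ‖(plaq (gaugeAct (combGauge U₀ U₁ z) U₁) y ρ ν : R) - plaq U₀ y ρ ν‖) s)
    (hq₀ : PlaqSup L z (fun y ρ ν => ‖(plaq U₀ y ρ ν : R) - 1‖) q₀)
    (hq₁ : PlaqSup L z (fun y ρ ν => ‖(plaq U₁ y ρ ν : R) - 1‖) q₁)
    (hτ₀ : ∀ x ρ, InBlock L z x → InBlock L z (x + e ρ) → ‖(U₀ x ρ : R) - 1‖ ≤ τ₀)
    (hτ₁ : ∀ x ρ, InBlock L z x → InBlock L z (x + e ρ) → ‖(U₁ x ρ : R) - 1‖ ≤ τ₁)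
    (hγU : ∀ μ x ρ, InBlock L z x → InBlock L z (x + e ρ) → InBlock L z (x + e μ) →
      InBlock L z (x + e μ + e ρ) → ‖(U₀ (x + e μ) ρ : R) - U₀ x ρ‖ ≤ γU)
    (hγ₀ : ∀ μ y ρ ν', ρ ≠ ν' → InBlock L z y → InBlock L z (y + e ρ) → InBlock L z (y + e ν') →
      InBlock L z (y + e ρ + e ν') → InBlock L z (y + e μ) → InBlock L z (y + e μ + e ρ) →
      InBlock L z (y + e μ + e ν') → InBlock L z (y + e μ + e ρ + e ν') →
      ‖(plaq U₀ (y + e μ) ρ ν' : R) - plaq U₀ y ρ ν'‖ ≤ γ₀)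
    (hγ₁ : ∀ μ y ρ ν', ρ ≠ ν' → InBlock L z y → InBlock L z (y + e ρ) → InBlock L z (y + e ν') →
      InBlock L z (y + e ρ + e ν') → InBlock L z (y + e μ) → InBlock L z (y + e μ + e ρ) →
      InBlock L z (y + e μ + e ν') → InBlock L z (y + e μ + e ρ + e ν') →
      ‖(plaq U₁ (y + e μ) ρ ν' : R) - plaq U₁ y ρ ν'‖ ≤ γ₁)
    (hs0 : 0 ≤ s) (hq0 : 0 ≤ q₀) (hq1 : 0 ≤ q₁) (hτ0 : 0 ≤ τ₀) (hτ1 : 0 ≤ τ₁) (hγU0 : 0 ≤ γU)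
    (hγ00 : 0 ≤ γ₀) (hγ10 : 0 ≤ γ₁)
    (hbw : winN κ ⟨((d : ℝ) - 1) * ((L : ℝ) - 1) * s,
        gradRaw d L s q₀ q₁ τ₀ τ₁ γU γ₀ γ₁ + ((d : ℝ) - 1) * ((L : ℝ) - 1) * s * γU,
        2 * (gradRaw d L s q₀ q₁ τ₀ τ₁ γU γ₀ γ₁ + ((d : ℝ) - 1) * ((L : ℝ) - 1) * s * γU)⟩ ≤ w) :
    ‖Fn (val U₁) - Fn (val U₀)‖ ≤ 4 * A / r *
      winN κ ⟨((d : ℝ) - 1) * ((L : ℝ) - 1) * s,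
        gradRaw d L s q₀ q₁ τ₀ τ₁ γU γ₀ γ₁ + ((d : ℝ) - 1) * ((L : ℝ) - 1) * s * γU,
        2 * (gradRaw d L s q₀ q₁ τ₀ τ₁ γU γ₀ γ₁ + ((d : ℝ) - 1) * ((L : ℝ) - 1) * s * γU)⟩ :=
  block_transport_window hinv hsl hκ hr hA hU₀𝒦 (unitaryLike_combGauge hU₀ hU₁ z)
    (windowData_comb_raw hβ hC hU₀ hU₁ hs hq₀ hq₁ hτ₀ hτ₁ hγU hγ₀ hγ₁ hs0 hq0 hq1 hτ0 hτ1 hγU0 hγ00 hγ10) hbw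

end Feed

/-! ## §6  [arith] Scale bookkeeping: the printed-format weights, the cost of the crude Hölder entry, the
interpolation exponent -/

section Scales

/-- [folklore] (arith; a CELL READING of the printed scales, NOT print) THE PRINTED-FORMAT WEIGHTS in bond-variable
units: `κ(θ) = (θ, θ², θ^{2+β})` with
`θ = L^{−j}` — from [Balaban1985RegularSpaces] (1.36) p. 82 "|A| < B₁(α₀+α₁)(L^jη)^{−1}, |∇^η_{U₀}A| <
B₁(α₀+α₁)(L^jη)^{−2}, ‖A‖_{1,β} < B₂(β₀)(α₀+α₁)(L^jη)^{−2−β}" for `U₁ = e^{iηA}`: the bond variable `U₁ − 1 ≈ iηA`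
carries one factor `η`, each `η`-lattice difference one more factor `η`, and a Hölder quotient over `m` lattice steps
the factor `(mη)^β`; so `η·(L^jη)^{−1} = L^{−j}`, `η²(L^jη)^{−2} = L^{−2j}`, `η^{2+β}(L^jη)^{−2−β} = L^{−j(2+β)}`. -/
noncomputable def printWin (θ β : ℝ) : Win := ⟨θ, θ ^ 2, θ ^ (2 + β)⟩

/-- [folklore] (arith) The printed-format weights are positive for `θ > 0`. -/
theorem printWin_pos {θ : ℝ} (hθ : 0 < θ) (β : ℝ) : (printWin θ β).Pos :=
  ⟨hθ, pow_pos hθ 2, Real.rpow_pos_of_pos hθ _⟩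

/-- [folklore] (arith) For `0 < θ ≤ 1`: `κ₀ = θ ≤ 1`, so §4's seam comparison applies to the printed weights. -/
theorem printWin_sup_le_one {θ : ℝ} (hθ1 : θ ≤ 1) (β : ℝ) : (printWin θ β).sup ≤ 1 := hθ1

/-- [folklore] (arith) The window condition in the printed weights, slot by slot. -/
theorem winN_printWin_le_iff {θ : ℝ} (hθ : 0 < θ) {β a : ℝ} {b : Win} :
    winN (printWin θ β) b ≤ a ↔ b.sup ≤ a * θ ∧ b.grad ≤ a * θ ^ 2 ∧ b.hol ≤ a * θ ^ (2 + β) :=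
  winN_le_iff (printWin_pos hθ β)

/-- [folklore] (arith) THE COST OF THE CRUDE HÖLDER ENTRY: with `b₂ = 2b₁` the window condition in the printed
weights demands `b₁ ≤ (a/2)·θ^{2+β}` — a factor `θ^β/2` BELOW the gradient slot's own `a·θ²`; since the comb
lineage delivers `b₁` at the rate `θ²` only, the crude entry does NOT close the printed window uniformly in `j`
(honest: this is WHY the second-difference datum (R2) matters). -/
theorem crude_needs {θ : ℝ} (hθ : 0 < θ) {β a b₀ b₁ : ℝ} (h : winN (printWin θ β) ⟨b₀, b₁, 2 * b₁⟩ ≤ a) :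
    b₁ ≤ a / 2 * θ ^ (2 + β) := by
  have h3 := ((winN_printWin_le_iff hθ).1 h).2.2
  simp only at h3
  linarith

/-- [folklore] (arith) THE INTERPOLATION EXPONENT: `(θ²)^{1−β}·(θ³)^β = θ^{2+β}` — first differences at rate `θ²` and
second differences at rate `θ³` ([Balaban1985BackgroundPropagators] (3.35)/(3.36) p. 396 FORMAT: `(L^jη)^{−2}`, `(L^jη)^{−3}`)
interpolate EXACTLY to the Hölder slot's rate. -/
theorem interp_exponent {θ : ℝ} (hθ : 0 < θ) (β : ℝ) : (θ ^ 2) ^ (1 - β) * (θ ^ 3) ^ β = θ ^ (2 + β) := by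
  rw [show (θ ^ 2 : ℝ) = θ ^ (2 : ℝ) by norm_cast, show (θ ^ 3 : ℝ) = θ ^ (3 : ℝ) by norm_cast,
    ← Real.rpow_mul hθ.le, ← Real.rpow_mul hθ.le, ← Real.rpow_add hθ]
  congr 1; ring

/-- [folklore] (arith) THE INTERPOLATED HÖLDER ENTRY AT THE PRINTED RATE: `b₁ ≤ a₁θ²` and `σ ≤ a₂θ³` give
`(2b₁)^{1−β}·σ^β ≤ (2a₁)^{1−β}·a₂^β·θ^{2+β}` (`0 ≤ β ≤ 1`, nonnegative data). -/
theorem interp_hol_entry {θ β b₁ σ a₁ a₂ : ℝ} (hθ : 0 < θ) (hβ0 : 0 ≤ β) (hβ1 : β ≤ 1) (hb₁ : 0 ≤ b₁)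
    (hσ : 0 ≤ σ) (h₁ : b₁ ≤ a₁ * θ ^ 2) (h₂ : σ ≤ a₂ * θ ^ 3) :
    (2 * b₁) ^ (1 - β) * σ ^ β ≤ (2 * a₁) ^ (1 - β) * a₂ ^ β * θ ^ (2 + β) := by
  have ha₁ : 0 ≤ a₁ := by nlinarith [pow_pos hθ 2]
  have ha₂ : 0 ≤ a₂ := by nlinarith [pow_pos hθ 3]
  calc (2 * b₁) ^ (1 - β) * σ ^ β ≤ (2 * (a₁ * θ ^ 2)) ^ (1 - β) * (a₂ * θ ^ 3) ^ β :=
        mul_le_mul (Real.rpow_le_rpow (by positivity) (by linarith) (by linarith))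
          (Real.rpow_le_rpow hσ h₂ hβ0) (Real.rpow_nonneg hσ _) (Real.rpow_nonneg (by positivity) _)
    _ = (2 * a₁) ^ (1 - β) * a₂ ^ β * ((θ ^ 2) ^ (1 - β) * (θ ^ 3) ^ β) := by
        rw [show 2 * (a₁ * θ ^ 2) = (2 * a₁) * θ ^ 2 by ring,
          Real.mul_rpow (by positivity) (by positivity), Real.mul_rpow ha₂ (by positivity)]
        ring
    _ = (2 * a₁) ^ (1 - β) * a₂ ^ β * θ ^ (2 + β) := by rw [interp_exponent hθ]

end Scales

/-! ## §7  Non-vacuity -/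

section Witness

/-- [folklore] The zero bond field has window data `(0, 0, 0)` on every block, every exponent. -/
theorem windowData_zero (L : ℕ) (z : Site d) (β : ℝ) : WindowData L z β (fun _ _ => (0 : R)) ⟨0, 0, 0⟩ where
  sup_nonneg := le_rfl
  grad_nonneg := le_rfl
  hol_nonneg := le_rfl
  sup x ν := by simp
  grad μ ν x _ _ _ := by simp
  hol μ ν ρ x m _ _ _ _ _ _ := by simp

/-- [folklore] … in particular the trivial pair in the trivial gauge (`blockDev_self_one`). -/
theorem windowData_self_one (L : ℕ) (z : Site d) (β : ℝ) (U : Cfg d R) :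
    WindowData L z β (blockDev L z (fun _ => 1) U U) ⟨0, 0, 0⟩ := by
  rw [blockDev_self_one]; exact windowData_zero L z β

variable [NormedAlgebra ℂ R] {F : Type*} [NormedAddCommGroup F] [NormedSpace ℂ F] [CompleteSpace F]

omit [CompleteSpace F] in
/-- [folklore] A CONSTANT block functional inhabits the window birth slice (entire slices, `Dm = univ`) — joint
non-vacuity of the hypotheses of `block_transport_window` with `GaugeInvariant` (trivial for constants); the
non-trivial toy inhabitants of the transport mechanism are upstream (`T4BirthChartTransport` §Toy,
`T4BlockTransport` §Toy). -/
theorem birthSlice_window_const {L : ℕ} {z : Site d} {β : ℝ} (κ : Win) (𝒦 : Set (Fld d R)) (w r : ℝ) {c : F}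
    {A : ℝ} (hc : ‖c‖ ≤ A) : BirthSlice (fun _ : Fld d R => c) (wMove L z β) (wN L z β κ) 𝒦 w r A :=
  fun _ _ _ _ _ => ⟨univ, differentiableOn_const c, fun _ _ => hc, fun _ _ => subset_univ _⟩

omit [NormedAddCommGroup F] [NormedSpace ℂ F] [CompleteSpace F] [NormedAlgebra ℂ R] in
/-- [folklore] Constants are block-gauge invariant. -/
theorem gaugeInvariant_const (L : ℕ) (z : Site d) (c : F) : GaugeInvariant (BlockRel (R := R) L z) (fun _ => c) :=
  fun _ _ _ => rfl

end Witness

end Literature.MathematicalPhysics.QuantumFieldTheory.Balaban1983to89.T4CombHolderWindow
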